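import Summits.BirchSwinnertonDyer.BirchSwinnertonDyer.Theorems.MordellShaFreeCutBDPTripleCensus

set_option linter.dupNamespace false
set_option autoImplicit false

/-! # Route `MordellShaFreeCut` (rung S2b) — the kernel census with Poitou–Tate demanded only at the
IMAGINARY QUADRATIC fields (the registered currency `stub_textbookDualityImQuad` of lines
`three-adic-bdp-triple` v5c / `heegner-field-bdp-triple` v6b)

Cell `bsd-cn100`, prover seat `bsd-cn100-s2b-c3` (g4). Supports, does not close,
stmt-BirchSwinnertonDyer-19160 (crux B `AnalyticRankOneOfRankOneFiniteShaThree`) and serves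
stmt-BirchSwinnertonDyer-19159 (residual crux A `RankPosOfThreeSelmerCorankOne`). HONEST FRAMING:
CONDITIONAL reductions only (the plan seat's v5c/v6b glue, landed BY NAME so that later skeletons and
the final discharge can call it); nothing here proves crux A, crux B, the leaf
`rankOne_threeConverse_mordellCurve`, Sylvester's conjecture or any case of BSD. No research
statement is restated: (res) at `3` is the hypothesis `hres` spelled exactly as the registered
`stub_threeLocNonDegeneracy`; the three BDP statements enter by their landed names
(`MordellShaFreeCutThreeAdicBDPTriple.{ThreeAdicBDPElementExists, ThreeAdicWanDivisibility,
ThreeAdicBDPValueAtOne}`, p439508); Poitou–Tate enters as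
`hPT : ∀ K, IsImaginaryQuadratic K → poitouTate_sum_localTatePairing_eq_zero K` — the statement of the
registered stub `stub_textbookDualityImQuad` (plan g12, 2026-08-26T12:12:54Z), i.e. Milne ADT I 4.10(b) at
the Heegner fields only, which is all the chain ever uses and which is the first milestone of the cell's
(F1) campaign (Poitou–Tate for totally complex `K`).

* `threeAdicControlOfRankOne_of_poitouTate_imaginaryQuadratic` — Link A (rank currency)
  `ThreeAdicControlOfRankOne` ⟸ Poitou–Tate at the imaginary quadratic fields (the v5c glue; same proof
  as `CongruentShaFreeCutTwoAdicControlOfPoitouTate.threeAdicControlOfRankOne_of_poitouTate`, p432373,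
  with `hPT K hK`);
* `threeAdicControlOfCorankOne_of_res_imaginaryQuadratic` — Link A (corank currency)
  `ThreeAdicControlOfCorankOne` ⟸ (res) at `3` + Poitou–Tate at the imaginary quadratic fields (the v6b
  glue; same proof as `MordellShaFreeCutResidualCensus.threeAdicControlOfCorankOne_of_res`, p438011);
* `cruxB_of_bdpTriple_of_poitouTate_imaginaryQuadratic` — **crux B ⟸ (LB-exist) + (LB-wan) + (LB-bdp) +
  Poitou–Tate(imaginary quadratic) + six refereed facts** (p439803's `cruxB_of_bdpTriple_of_poitouTate`
  with the weaker textbook input);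
* `cruxA_of_res_of_bdpTriple_of_poitouTate_imaginaryQuadratic`,
  `cruxA_iff_res_of_bdpTriple_of_poitouTate_imaginaryQuadratic`,
  `leaf_of_res_of_bdpTriple_of_poitouTate_imaginaryQuadratic` — the residual's census and THE ROUTE'S
  census (p440480's theorems) with the weaker textbook input: **leaf ⟸ {(res) at `3`, (LB-exist),
  (LB-wan), (LB-bdp)} + Poitou–Tate(imaginary quadratic) + six refereed facts**.

When the (F1) milestone `poitouTate_sum_localTatePairing_eq_zero K` for totally complex (or imaginary
quadratic) `K` lands, each `hPT` here is discharged by it (`IsImaginaryQuadratic.isTotallyComplex`).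

[cite: MilneADT2006, Ch. I, Thm. 4.10(b) (hypothesis kept, at imaginary quadratic fields)]
[cite: JetchevSkinnerWan2017, Prop. 3.2.1 and §3.3] [cite: Skinner2020, Thm. B, §2.2–2.3 (shape of (res))]
[cite: CastellaGrossiLeeSkinner2022, §5.2 (proof of Thm. 5.2.1), Thm. 5.1.3]
[cite: GrossZagier1986, Thm. I.6.3 with V.§2] -/

noncomputable section

open scoped Classical

namespace Summit.BirchSwinnertonDyer.BirchSwinnertonDyer.Theorems.MordellShaFreeCutPoitouTateImQuad

open PowerSeries WeierstrassCurve NumberField IsDedekindDomain Field Literature.NumberTheory.EllipticCurves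
  Literature.NumberTheory.EllipticCurves.ModularForms Literature.NumberTheory.QuadraticFields
  Literature.NumberTheory.EllipticCurves.Castella2018
open Literature.NumberTheory.GaloisRepresentations Literature.NumberTheory.GaloisCohomology
open Summit.BirchSwinnertonDyer.BirchSwinnertonDyer.Theses.MordellShaFreeCut
open Summit.BirchSwinnertonDyer.BirchSwinnertonDyer.Theorems.MordellShaFreeCutThreeAdicLinks
  (ThreeAdicControlOfRankOne)
open Summit.BirchSwinnertonDyer.BirchSwinnertonDyer.Theorems.MordellShaFreeCutThreeAdicBDPTriple
  (ThreeAdicBDPElementExists ThreeAdicWanDivisibility ThreeAdicBDPValueAtOne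
    stub_heegnerNonTorsion_of_linkA_of_bdpTriple)
open Summit.BirchSwinnertonDyer.BirchSwinnertonDyer.Theorems.MordellShaFreeCutThreeAdicLinksCorank
  (ThreeAdicControlOfCorankOne)
open Summit.BirchSwinnertonDyer.BirchSwinnertonDyer.Theorems.MordellShaFreeCutBDPTripleCensus
  (rankPos_minimal_of_corankLinkA_of_bdpTriple)
open Summit.BirchSwinnertonDyer.BirchSwinnertonDyer.Theorems.MordellShaFreeCutLocNonDegeneracy
  (threeLocNonDegeneracy_of_cruxA)

/-! ## 1. Link A from Poitou–Tate at the imaginary quadratic fields -/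

/-- **Link A of S2b `ThreeAdicControlOfRankOne` granted Poitou–Tate AT THE IMAGINARY QUADRATIC FIELDS**
(the v5c glue of the plan seat, landed by name; the imaginary-quadratic variant of the tree theorem
`CongruentShaFreeCutTwoAdicControlOfPoitouTate.threeAdicControlOfRankOne_of_poitouTate`, p432373 — same
proof with `hPT K hK`: base finiteness `finite_selmerAcBase_of_rankOne_of_poitouTate W 3 K` and the tower
control `hasCharValuationAt_of_finite_selmerAcBase W 3`, p429171). CONDITIONAL on its hypothesis; credits
nothing. [cite: MilneADT2006, Ch. I, Thm. 4.10(b) (hypothesis kept)] [cite: JetchevSkinnerWan2017, Prop. 3.2.1 and §3.3] -/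
theorem threeAdicControlOfRankOne_of_poitouTate_imaginaryQuadratic
    (hPT : ∀ (K : Type) [Field K] [NumberField K], IsImaginaryQuadratic K →
      poitouTate_sum_localTatePairing_eq_zero K) :
    ThreeAdicControlOfRankOne := by
  intro W _ _ _hj K _ _ N _ _hN hK _hHN hH3 ι v vbar _hv hvbar _hne κ hκ γ _ hrank hsha
  have hsplit : Summit.BirchSwinnertonDyer.Rank1Residual.X11b.SplitsIn K 3 := hH3 3 Fact.out (dvd_refl 3)
  haveI : Finite (Summit.BirchSwinnertonDyer.Rank1Residual.X11b.AcSelmer.selmerAcBase (W.baseChange K) 3 vbar ∅) :=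
    CongruentShaFreeCutTwoAdicControlOfPoitouTate.finite_selmerAcBase_of_rankOne_of_poitouTate W 3 K (hPT K hK)
      hK hsplit hrank hsha vbar hvbar
  exact CongruentShaFreeCutTwoAdicControlOfSelmerFinite.hasCharValuationAt_of_finite_selmerAcBase W 3 hK hsplit
    κ hκ γ vbar hvbar

/-- **Link A in CORANK currency `ThreeAdicControlOfCorankOne` ⟸ (res) at `3` + Poitou–Tate AT THE IMAGINARY
QUADRATIC FIELDS** (the v6b glue of the plan seat, landed by name; the imaginary-quadratic variant of
`MordellShaFreeCutResidualCensus.threeAdicControlOfCorankOne_of_res`, p438011 — same proof with `hPT K hK`: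
the landed W,p-general algebra `CongruentShaFreeCutSelmerFiniteOfRes.stub_selmerAcBaseFinite_of_resCorankOne`
(p437699) makes Castella's base Selmer group finite from (res), corank one, Poitou–Tate at `K` and the
local Euler characteristic (tree theorem), and the tower control `hasCharValuationAt_of_finite_selmerAcBase
W 3` (p429171) gives the generator). CONDITIONAL on its hypotheses; credits nothing.
[cite: Skinner2020, §2.3 Lemma 2.3.2 (shape)] [cite: MilneADT2006, Ch. I, Thm. 4.10(b) (hypothesis kept) and Thm. 2.8] -/
theorem threeAdicControlOfCorankOne_of_res_imaginaryQuadratic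
    (hPT : ∀ (K : Type) [Field K] [NumberField K], IsImaginaryQuadratic K →
      poitouTate_sum_localTatePairing_eq_zero K)
    (hres : ∀ (W : WeierstrassCurve ℚ) [W.IsElliptic] [W.IsGloballyMinimal], W.j = 0 →
      ∀ (K : Type) [Field K] [NumberField K],
      IsImaginaryQuadratic K → SatisfiesHeegnerHypothesis 3 K →
        (W.baseChange K).selmerCorank 3 = 1 →
      ∀ (w : HeightOneSpectrum (𝓞 K)), ((3 : ℕ) : 𝓞 K) ∈ w.asIdeal →
        Finite ↥((W.baseChange K).selmerGroupPInfty 3 ⊓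
          selmerLocalKerPrimaryTorsion (W.baseChange K) (w.adicCompletion K) 3)) :
    ThreeAdicControlOfCorankOne := by
  intro W _ _ hj K _ _ N _ _hN hK _hHN hH3 ι v vbar _hv hvbar _hne κ hκ γ _ hcK
  have hsplit : Summit.BirchSwinnertonDyer.Rank1Residual.X11b.SplitsIn K 3 := hH3 3 Fact.out (dvd_refl 3)
  haveI : Finite (Summit.BirchSwinnertonDyer.Rank1Residual.X11b.AcSelmer.selmerAcBase (W.baseChange K) 3 vbar ∅) :=
    CongruentShaFreeCutSelmerFiniteOfRes.stub_selmerAcBaseFinite_of_resCorankOne W 3 K (hPT K hK)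
      (Summit.BirchSwinnertonDyer.Rank1Residual.GaloisImage.EP.forall_localEulerPoincareCharacteristic_adicCompletion K)
      hK hsplit hcK (hres W hj K hK hH3 hcK) vbar hvbar
  exact CongruentShaFreeCutTwoAdicControlOfSelmerFinite.hasCharValuationAt_of_finite_selmerAcBase
    W 3 hK hsplit κ hκ γ vbar hvbar

/-! ## 2. Crux B (stmt-19160) from the BDP triple with Poitou–Tate at the imaginary quadratic fields -/

/-- **Crux B `AnalyticRankOneOfRankOneFiniteShaThree` ⟸ (LB-exist) + (LB-wan) + (LB-bdp) + Poitou–Tate at the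
imaginary quadratic fields + six refereed facts** — the attacked crux's kernel census in the registered v5c
currency: the landed `MordellShaFreeCutOfHeegnerNonTorsion.analyticRankOne_of_facts_of_heegnerNonTorsion`
(p419697) fed with the landed plumbing `stub_heegnerNonTorsion_of_linkA_of_bdpTriple` (p439508), Kato, and
Link A := `threeAdicControlOfRankOne_of_poitouTate_imaginaryQuadratic hPT` — token for token p439803's
`cruxB_of_bdpTriple_of_poitouTate` with the weaker textbook input. CONDITIONAL; credits nothing beyond the
reduction. [cite: CastellaGrossiLeeSkinner2022, §5.2 (proof of Thm. 5.2.1)] [cite: GrossZagier1986, Thm. I.6.3 with V.§2]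
[cite: MilneADT2006, Ch. I, Thm. 4.10(b) (hypothesis kept)] -/
theorem cruxB_of_bdpTriple_of_poitouTate_imaginaryQuadratic
    (hpar : ∀ (W : WeierstrassCurve ℚ) [W.IsElliptic] (p : ℕ) [Fact p.Prime], p_parity W p)
    (hmod : ModularForms.exists_isNewformOf) (hHL : HoffsteinLuo1997_exists_twist_L_one_ne_zero)
    (hKato : ∀ (W : WeierstrassCurve ℚ) [W.IsElliptic] (p : ℕ) [Fact p.Prime],
      kato_finite_of_L_one_ne_zero W p)
    (hHP : ∀ (W : WeierstrassCurve ℚ) (K : Type) [Field K] [NumberField K],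
      exists_isHeegnerPoint W K)
    (hGZ : ∀ (W : WeierstrassCurve ℚ) (N : ℕ) [NeZero N] (K : Type) [Field K] [NumberField K],
      analyticRankEK_eq_one_iff_heegner_nonTorsion W N K)
    (hPT : ∀ (K : Type) [Field K] [NumberField K], IsImaginaryQuadratic K →
      poitouTate_sum_localTatePairing_eq_zero K)
    (hE : ThreeAdicBDPElementExists) (hWan : ThreeAdicWanDivisibility) (hV : ThreeAdicBDPValueAtOne) :
    AnalyticRankOneOfRankOneFiniteShaThree :=
  MordellShaFreeCutOfHeegnerNonTorsion.analyticRankOne_of_facts_of_heegnerNonTorsion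
    hpar hmod hHL hKato hHP hGZ
    (stub_heegnerNonTorsion_of_linkA_of_bdpTriple hKato
      (threeAdicControlOfRankOne_of_poitouTate_imaginaryQuadratic hPT) hE hWan hV)

/-! ## 3. Crux A (stmt-19159, residual) and the leaf, with Poitou–Tate at the imaginary quadratic fields -/

/-- **Crux A `RankPosOfThreeSelmerCorankOne` ⟸ (res) at `3` + the BDP triple + Poitou–Tate at the imaginary
quadratic fields + five refereed facts** (p440480's `cruxA_of_res_of_bdpTriple_of_poitouTate` with the weaker
textbook input; Link A in corank form := `threeAdicControlOfCorankOne_of_res_imaginaryQuadratic hPT hres`,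
minimal-model reduction, `rankPos_minimal_of_corankLinkA_of_bdpTriple`). CONDITIONAL; credits nothing.
[cite: Skinner2020, Thm. B and §2.2–2.3 (shape of (res))] [cite: CastellaGrossiLeeSkinner2022, §5.2 (proof of Thm. 5.2.1)] -/
theorem cruxA_of_res_of_bdpTriple_of_poitouTate_imaginaryQuadratic
    (hpar : ∀ (W : WeierstrassCurve ℚ) [W.IsElliptic] (p : ℕ) [Fact p.Prime], p_parity W p)
    (hmod : ModularForms.exists_isNewformOf) (hHL : HoffsteinLuo1997_exists_twist_L_one_ne_zero)
    (hKato : ∀ (W : WeierstrassCurve ℚ) [W.IsElliptic] (p : ℕ) [Fact p.Prime],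
      kato_finite_of_L_one_ne_zero W p)
    (hHP : ∀ (W : WeierstrassCurve ℚ) (K : Type) [Field K] [NumberField K],
      exists_isHeegnerPoint W K)
    (hPT : ∀ (K : Type) [Field K] [NumberField K], IsImaginaryQuadratic K →
      poitouTate_sum_localTatePairing_eq_zero K)
    (hres : ∀ (W : WeierstrassCurve ℚ) [W.IsElliptic] [W.IsGloballyMinimal], W.j = 0 →
      ∀ (K : Type) [Field K] [NumberField K],
      IsImaginaryQuadratic K → SatisfiesHeegnerHypothesis 3 K →
        (W.baseChange K).selmerCorank 3 = 1 →
      ∀ (w : HeightOneSpectrum (𝓞 K)), ((3 : ℕ) : 𝓞 K) ∈ w.asIdeal →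
        Finite ↥((W.baseChange K).selmerGroupPInfty 3 ⊓
          selmerLocalKerPrimaryTorsion (W.baseChange K) (w.adicCompletion K) 3))
    (hE : ThreeAdicBDPElementExists) (hWan : ThreeAdicWanDivisibility) (hV : ThreeAdicBDPValueAtOne) :
    RankPosOfThreeSelmerCorankOne := by
  intro D hD hc
  haveI := isElliptic_mordellCurve hD
  haveI : Fact (Nat.Prime 3) := ⟨Nat.prime_three⟩
  obtain ⟨C, hmin⟩ := hasGlobalMinimalModel_rat_holds (mordellCurve D)
  haveI : (C • mordellCurve D).IsGloballyMinimal := hmin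
  have hj : (C • mordellCurve D).j = 0 := by
    rw [variableChange_j]; exact (mordellCurve D).j_eq_zero (mordellCurve_c₄ _)
  have hc' : (C • mordellCurve D).selmerCorank 3 = 1 := by
    rw [← selmerCorank_eq_of_variableChange 3 (rfl : C • mordellCurve D = C • mordellCurve D)]
    exact hc
  have h1 := rankPos_minimal_of_corankLinkA_of_bdpTriple hpar hmod hHL hKato hHP
    (threeAdicControlOfCorankOne_of_res_imaginaryQuadratic hPT hres) hE hWan hV (C • mordellCurve D) hj hc'
  rwa [mordellWeilRank_variableChange_holds] at h1

/-- **Kernel census of the residual: modulo the BDP triple, Poitou–Tate at the imaginary quadratic fields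
and five refereed facts, crux A `RankPosOfThreeSelmerCorankOne` ⟺ (res) at `3`** (`⟸`:
`cruxA_of_res_of_bdpTriple_of_poitouTate_imaginaryQuadratic`; `⟹`: the fact-free
`MordellShaFreeCutLocNonDegeneracy.threeLocNonDegeneracy_of_cruxA`, p435058). CONDITIONAL; credits nothing.
[cite: Skinner2020, Thm. B and §2.2 (shape of (res))] [cite: WZhang2014, Thm. 1.3 and Remark 2 (p. 198)] -/
theorem cruxA_iff_res_of_bdpTriple_of_poitouTate_imaginaryQuadratic
    (hpar : ∀ (W : WeierstrassCurve ℚ) [W.IsElliptic] (p : ℕ) [Fact p.Prime], p_parity W p)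
    (hmod : ModularForms.exists_isNewformOf) (hHL : HoffsteinLuo1997_exists_twist_L_one_ne_zero)
    (hKato : ∀ (W : WeierstrassCurve ℚ) [W.IsElliptic] (p : ℕ) [Fact p.Prime],
      kato_finite_of_L_one_ne_zero W p)
    (hHP : ∀ (W : WeierstrassCurve ℚ) (K : Type) [Field K] [NumberField K],
      exists_isHeegnerPoint W K)
    (hPT : ∀ (K : Type) [Field K] [NumberField K], IsImaginaryQuadratic K →
      poitouTate_sum_localTatePairing_eq_zero K)
    (hE : ThreeAdicBDPElementExists) (hWan : ThreeAdicWanDivisibility) (hV : ThreeAdicBDPValueAtOne) :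
    RankPosOfThreeSelmerCorankOne ↔
      ∀ (W : WeierstrassCurve ℚ) [W.IsElliptic] [W.IsGloballyMinimal], W.j = 0 →
        ∀ (K : Type) [Field K] [NumberField K],
        IsImaginaryQuadratic K → SatisfiesHeegnerHypothesis 3 K →
          (W.baseChange K).selmerCorank 3 = 1 →
        ∀ (w : HeightOneSpectrum (𝓞 K)), ((3 : ℕ) : 𝓞 K) ∈ w.asIdeal →
          Finite ↥((W.baseChange K).selmerGroupPInfty 3 ⊓
            selmerLocalKerPrimaryTorsion (W.baseChange K) (w.adicCompletion K) 3) :=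
  ⟨fun hA W _ _ hj K _ _ hK hH3 hcK w hw ↦ threeLocNonDegeneracy_of_cruxA hA W hj K hK hH3 hcK w hw,
    fun hres ↦ cruxA_of_res_of_bdpTriple_of_poitouTate_imaginaryQuadratic hpar hmod hHL hKato hHP hPT hres
      hE hWan hV⟩

/-- **THE ROUTE'S KERNEL CENSUS with Poitou–Tate at the imaginary quadratic fields: the rung-S2b leaf
`rankOne_threeConverse_mordellCurve` ⟸ {(res) at `3`, (LB-exist), (LB-wan), (LB-bdp)} +
Poitou–Tate(imaginary quadratic) + six refereed facts** (`3`-parity, modularity, Hoffstein–Luo, Kato,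
Gross 1984, Gross–Zagier + Kolyvagin): the route's Assembly (`MordellShaFreeCutAssembly.assembly_holds`) of
crux A (`cruxA_of_res_of_bdpTriple_of_poitouTate_imaginaryQuadratic`) and crux B
(`cruxB_of_bdpTriple_of_poitouTate_imaginaryQuadratic`). After the (F1) milestone lands, the textbook
hypothesis disappears. CONDITIONAL; neither BSD nor Sylvester's conjecture is touched.
[cite: GrossZagier1986, Thm. I.6.3 with V.§2] [cite: CastellaGrossiLeeSkinner2022, §5.2 (proof of Thm. 5.2.1)]
[cite: MilneADT2006, Ch. I, Thm. 4.10(b) (hypothesis kept)] -/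
theorem leaf_of_res_of_bdpTriple_of_poitouTate_imaginaryQuadratic
    (hpar : ∀ (W : WeierstrassCurve ℚ) [W.IsElliptic] (p : ℕ) [Fact p.Prime], p_parity W p)
    (hmod : ModularForms.exists_isNewformOf) (hHL : HoffsteinLuo1997_exists_twist_L_one_ne_zero)
    (hKato : ∀ (W : WeierstrassCurve ℚ) [W.IsElliptic] (p : ℕ) [Fact p.Prime],
      kato_finite_of_L_one_ne_zero W p)
    (hHP : ∀ (W : WeierstrassCurve ℚ) (K : Type) [Field K] [NumberField K],
      exists_isHeegnerPoint W K)
    (hGZ : ∀ (W : WeierstrassCurve ℚ) (N : ℕ) [NeZero N] (K : Type) [Field K] [NumberField K],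
      analyticRankEK_eq_one_iff_heegner_nonTorsion W N K)
    (hPT : ∀ (K : Type) [Field K] [NumberField K], IsImaginaryQuadratic K →
      poitouTate_sum_localTatePairing_eq_zero K)
    (hres : ∀ (W : WeierstrassCurve ℚ) [W.IsElliptic] [W.IsGloballyMinimal], W.j = 0 →
      ∀ (K : Type) [Field K] [NumberField K],
      IsImaginaryQuadratic K → SatisfiesHeegnerHypothesis 3 K →
        (W.baseChange K).selmerCorank 3 = 1 →
      ∀ (w : HeightOneSpectrum (𝓞 K)), ((3 : ℕ) : 𝓞 K) ∈ w.asIdeal →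
        Finite ↥((W.baseChange K).selmerGroupPInfty 3 ⊓
          selmerLocalKerPrimaryTorsion (W.baseChange K) (w.adicCompletion K) 3))
    (hE : ThreeAdicBDPElementExists) (hWan : ThreeAdicWanDivisibility) (hV : ThreeAdicBDPValueAtOne) :
    rankOne_threeConverse_mordellCurve :=
  MordellShaFreeCutAssembly.assembly_holds
    (cruxA_of_res_of_bdpTriple_of_poitouTate_imaginaryQuadratic hpar hmod hHL hKato hHP hPT hres hE hWan hV)
    (cruxB_of_bdpTriple_of_poitouTate_imaginaryQuadratic hpar hmod hHL hKato hHP hGZ hPT hE hWan hV)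

end Summit.BirchSwinnertonDyer.BirchSwinnertonDyer.Theorems.MordellShaFreeCutPoitouTateImQuad

end
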